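import Literature.NumberTheory.Multiplicative.CorradiKatai1969.Density
import HarnessLib

/-!
# Corrádi–Kátai (1969), Conjecture 1 is FALSE — the sign-flip counterexample, unconditionally

Source: K. A. Corrádi and I. Kátai, *Some problems concerning the convolutions of number-theoretical functions*,
Arch. Math. (Basel) **20** (1969) 24–29, doi:10.1007/BF01898986 [CorradiKatai1969], p. 25: the class `M` of
multiplicative `±1`-valued functions, `h_f(n) = Σ_{ν=1}^{n−1} f(ν)f(n−ν)` ((1.1)), relation (1.2) `h_f(n) = o(n)`,
`C(f) = Σ_{p : f(p) = −1} 1/p`, "character-type" (periodic on the residues coprime to some `K ≥ 1`), and their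
**Conjecture 1** (p. 25, verbatim modulo notation): "If f ∈ M and f is not a 'character-type', then for the fulfilment
of (1.2) the condition C(f) = ∞ is a necessary and sufficient one."  CATEGORY: an explicitly labelled conjecture,
REFUTED (the sufficiency half fails) by an explicit family of counterexamples.  The analytic input is Dirichlet's
theorem in the form `Σ_{p ≡ a (k)} 1/p = ∞` for `(a,k) = 1` (H. L. Montgomery, R. C. Vaughan, *Multiplicative Number
Theory I*, CUP 2007 [MontgomeryVaughan2007], Cor. 4.12(c), p. 103), which is the tree theorem
`Literature.NumberTheory.LFunctions.not_summable_one_div_on_primes_in_residueClass` — so everything here is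
unconditional (standard axioms).

Counterexample (2001 H21 programme, Theorem 1.1 = `theoremCE`): for any infinite set `R` of odd primes with
`Σ_{p∈R} 1/p ≤ 1/8` (finitary form: every finite subsum `≤ 1/8`; one is constructed, `exists_admissible_R`: the least
primes above `16^{j+1}`), the completely multiplicative `f = fCE R` with `f(2) = 1`, `f(p) = χ₄(p)` (`p ∉ R`),
`f(p) = −χ₄(p)` (`p ∈ R`) has `C(f) = ∞`, is not of character-type, and `h_f(2^s) ≤ −2^{s−1} + 3` for all `s ≥ 2`
(unperturbed: `h_{f₀}(2^s) = −2^s + 3`, Lemma 2.1 `hCK_f0_two_pow`; thin-flip comparison `hCK_fCE_two_pow_le`), so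
`h_f(n) ≠ o(n)`: sufficiency fails, **`ckStatementOne_false : ¬ CKStatementOne`**.

This module (2001 file, last part, + the bundle's unconditional wrapper): `seqR`, `exists_admissible_R` (non-vacuity:
an infinite set of odd primes with all finite reciprocal subsums `≤ 1/15 ≤ 1/8`), the statement `CKStatementOne`
(Conjecture 1 of the paper as a `Prop`; a cited definition kept because the refutation names it — no `_holds` can
exist), `ckStatementOne_false_of (hdir)` (the 2001 conditional shape), **`ckStatementOne_false : ¬ CKStatementOne`**
(unconditional, via `dirichletReciprocalDivergence` of `Defs`), `counterexample` (Theorem CE with the hypothesis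
discharged), and smoke tests (the definitions are not vacuous).

Modules: `Literature.NumberTheory.Multiplicative.CorradiKatai1969.Defs` (objects, the interface Prop and its proof, the construction `f₀`, `Ω_R`, `fCE` and basic
facts), `.ThinFlip` (Lemma 2.1 and the thin-flip comparison: `h_f(2^s) ≤ −2^{s−1} + 3`), `.Density` (`C(f) = ∞`, not
character-type, `h_f ≠ o(n)`, `theoremCE`), `.Refutation` (an admissible `R` exists, `CKStatementOne`,
`ckStatementOne_false`, smoke tests).

Provenance: refutations bundle `papers/_cross/refutations` (H21 seat pub-refute-2, 2026-08-18), package modules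
`Refutations.Vendor2001.CorradiKatai` (the 2001 H21 programme's kernel-checked file, archive route `summits/gb/free/y10`,
refereed note Theorem 1.1, "upheld 2026-08-07"; namespace `CorradiKatai` there) and `Refutations.CorradiKatai1969`
(the unconditional wrapper), moved into the tree under the Lean-in-tree rule (human 2026-08-18).  Renamed:
`CKConjectureOne ↦ CKStatementOne`, `ckConjectureOne_false (hdir) ↦ ckStatementOne_false_of`, and the unconditional
`corradiKataiConjecture1_false ↦ ckStatementOne_false`; the 2001 interface Prop `DirichletReciprocalDivergence` is kept
and PROVED (`dirichletReciprocalDivergence`, module `Defs`).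
-/

open Finset

namespace Literature.NumberTheory.Multiplicative.CorradiKatai1969

noncomputable section
open scoped Classical

/-! ### An admissible `R` exists (non-vacuity of Theorem 1.1)

The paper's example after Theorem 1.1: `R = {p_j : j ≥ 1}`, `p_j` the least prime
exceeding `16^j`, is admissible.  We build a strictly increasing sequence of primes
`seqR j > 16^{j+1}` recursively from the infinitude of primes; then
`∑_j 1/seqR j < ∑_{j≥1} 16^{−j} = 1/15 ≤ 1/8`. -/

/-- `seqR j`: a strictly increasing sequence of primes with `seqR j > 16^{j+1}`. [folklore] -/
def seqR : ℕ → ℕ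
  | 0 => Nat.find (Nat.exists_infinite_primes 17)
  | j + 1 => Nat.find (Nat.exists_infinite_primes (max (16 ^ (j + 2)) (seqR j) + 1))

/-- Auxiliary lemma: `(j : ℕ) : (seqR j).Prime`. [folklore] -/
theorem seqR_prime (j : ℕ) : (seqR j).Prime := by
  cases j with
  | zero => exact (Nat.find_spec (Nat.exists_infinite_primes 17)).2
  | succ j => exact (Nat.find_spec (Nat.exists_infinite_primes
      (max (16 ^ (j + 2)) (seqR j) + 1))).2

/-- Auxiliary lemma: `(j : ℕ) : 16 ^ (j + 1) < seqR j`. [folklore] -/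
theorem seqR_gt (j : ℕ) : 16 ^ (j + 1) < seqR j := by
  cases j with
  | zero =>
    have h := (Nat.find_spec (Nat.exists_infinite_primes 17)).1
    have h16 : (16 : ℕ) ^ (0 + 1) = 16 := by norm_num
    show 16 ^ (0 + 1) < Nat.find (Nat.exists_infinite_primes 17)
    omega
  | succ j =>
    have h := (Nat.find_spec (Nat.exists_infinite_primes
      (max (16 ^ (j + 2)) (seqR j) + 1))).1
    have h2 : 16 ^ (j + 2) < Nat.find (Nat.exists_infinite_primes
        (max (16 ^ (j + 2)) (seqR j) + 1)) := by
      have := le_max_left (16 ^ (j + 2)) (seqR j)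
      omega
    simpa [seqR] using h2

/-- Auxiliary lemma: `(j : ℕ) : seqR j < seqR (j + 1)`. [folklore] -/
theorem seqR_lt_succ (j : ℕ) : seqR j < seqR (j + 1) := by
  have h := (Nat.find_spec (Nat.exists_infinite_primes
    (max (16 ^ (j + 2)) (seqR j) + 1))).1
  have h2 := le_max_right (16 ^ (j + 2)) (seqR j)
  show seqR j < Nat.find (Nat.exists_infinite_primes (max (16 ^ (j + 2)) (seqR j) + 1))
  omega

/-- Auxiliary lemma: `: StrictMono seqR`. [folklore] -/
theorem seqR_strictMono : StrictMono seqR := strictMono_nat_of_lt_succ seqR_lt_succ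

/-- Auxiliary lemma: `(j : ℕ) : seqR j % 2 = 1`. [folklore] -/
theorem seqR_odd (j : ℕ) : seqR j % 2 = 1 := by
  have hgt := seqR_gt j
  have h16 : 16 ≤ 16 ^ (j + 1) := by
    calc (16 : ℕ) = 16 ^ 1 := (pow_one 16).symm
    _ ≤ 16 ^ (j + 1) := Nat.pow_le_pow_right (by norm_num) (by omega)
  have hodd : Odd (seqR j) := (seqR_prime j).odd_of_ne_two (by omega)
  exact Nat.odd_iff.mp hodd

/-- Auxiliary lemma: `(F : Finset ℕ) (hF : ∀ p ∈ F, p ∈ Set.range seqR) : ∑ p ∈ F, (1 : ℝ) / p ≤ 1 / 8`. [folklore] -/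
theorem seqR_sum_le (F : Finset ℕ) (hF : ∀ p ∈ F, p ∈ Set.range seqR) :
    ∑ p ∈ F, (1 : ℝ) / p ≤ 1 / 8 := by
  have hinj : Function.Injective seqR := seqR_strictMono.injective
  -- the geometric dominating series
  have hsummable : Summable fun j : ℕ => (1 / 16 : ℝ) ^ (j + 1) := by
    have h := (summable_geometric_of_lt_one (r := (1 / 16 : ℝ)) (by norm_num)
      (by norm_num)).mul_left (1 / 16 : ℝ)
    refine h.congr fun j => ?_
    rw [pow_succ]
    ring
  have htsum : ∑' j : ℕ, (1 / 16 : ℝ) ^ (j + 1) = 1 / 15 := by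
    have h1 : ∀ j : ℕ, (1 / 16 : ℝ) ^ (j + 1) = (1 / 16) * (1 / 16) ^ j := fun j => by
      rw [pow_succ]
      ring
    rw [tsum_congr h1, tsum_mul_left,
      tsum_geometric_of_lt_one (by norm_num) (by norm_num)]
    norm_num
  -- reindex the sum over F ⊆ range seqR through the indices
  set J := F.image (Function.invFun seqR) with hJ
  have hFsub : F ⊆ J.image seqR := by
    intro q hq
    obtain ⟨j, hj⟩ := hF q hq
    have hinv : seqR (Function.invFun seqR q) = q := Function.invFun_eq ⟨j, hj⟩
    exact Finset.mem_image.mpr ⟨Function.invFun seqR q,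
      Finset.mem_image_of_mem _ hq, hinv⟩
  have hstep1 : ∑ p ∈ F, (1 : ℝ) / p ≤ ∑ p ∈ J.image seqR, (1 : ℝ) / p := by
    apply Finset.sum_le_sum_of_subset_of_nonneg hFsub
    intro i _ _
    positivity
  have hstep2 : ∑ p ∈ J.image seqR, (1 : ℝ) / p = ∑ j ∈ J, (1 : ℝ) / seqR j :=
    Finset.sum_image fun x _ y _ hxy => hinj hxy
  have hstep3 : ∑ j ∈ J, (1 : ℝ) / seqR j ≤ ∑ j ∈ J, (1 / 16 : ℝ) ^ (j + 1) := by
    refine Finset.sum_le_sum fun j _ => ?_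
    have hgt : (16 : ℝ) ^ (j + 1) ≤ (seqR j : ℝ) := by
      exact_mod_cast (seqR_gt j).le
    have hpos : (0 : ℝ) < 16 ^ (j + 1) := by positivity
    have h2 : (1 : ℝ) / (seqR j : ℝ) ≤ 1 / (16 : ℝ) ^ (j + 1) :=
      one_div_le_one_div_of_le hpos hgt
    calc (1 : ℝ) / (seqR j : ℝ) ≤ 1 / (16 : ℝ) ^ (j + 1) := h2
    _ = (1 / 16 : ℝ) ^ (j + 1) := by rw [div_pow, one_pow]
  have hstep4 : ∑ j ∈ J, (1 / 16 : ℝ) ^ (j + 1) ≤ ∑' j : ℕ, (1 / 16 : ℝ) ^ (j + 1) :=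
    hsummable.sum_le_tsum J fun j _ => by positivity
  calc ∑ p ∈ F, (1 : ℝ) / p ≤ ∑ j ∈ J, (1 : ℝ) / seqR j := by rw [← hstep2]; exact hstep1
  _ ≤ ∑ j ∈ J, (1 / 16 : ℝ) ^ (j + 1) := hstep3
  _ ≤ ∑' j : ℕ, (1 / 16 : ℝ) ^ (j + 1) := hstep4
  _ = 1 / 15 := htsum
  _ ≤ 1 / 8 := by norm_num

/-- Non-vacuity: an admissible `R` for Theorem 1.1 exists — an infinite set of odd
primes, every finite reciprocal subsum `≤ 1/8` (paper: the example after Theorem 1.1). [folklore] -/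
theorem exists_admissible_R :
    ∃ R : Set ℕ, R.Infinite ∧ (∀ p ∈ R, Nat.Prime p ∧ p % 2 = 1) ∧
      ∀ F : Finset ℕ, (∀ p ∈ F, p ∈ R) → ∑ p ∈ F, (1 : ℝ) / p ≤ 1 / 8 := by
  refine ⟨Set.range seqR, ?_, ?_, seqR_sum_le⟩
  · exact Set.infinite_range_of_injective seqR_strictMono.injective
  · rintro p ⟨j, rfl⟩
    exact ⟨seqR_prime j, seqR_odd j⟩

/-! ### Conjecture 1 of Corrádi–Kátai, and its refutation -/

/-- The first of the two statements proposed on p. 25 of Corrádi–Kátai (Arch. Math. 20 (1969)), rendered verbatim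
modulo notation: "If `f ∈ M` and `f` is not a character-type, then for the fulfilment of `h_f(n) = o(n)` the
condition `C(f) = ∞` is a necessary and sufficient one."  **REFUTED in this file** (`ckStatementOne_false`: the
sufficiency half fails for every `fCE R`, `R` admissible).  Bundle / 2001 name: see the module docstring. [cite: CorradiKatai1969, p. 25 Conj. 1] -/
def CKStatementOne : Prop :=
  ∀ f : ℕ → ℤ, IsMultPM f → ¬ IsCharacterType f → (IsLittleO (hCK f) ↔ CInfinite f)

/-- The 2001 theorem in its original conditional shape: granting the analytic interface
`DirichletReciprocalDivergence`, the sufficiency half of `CKStatementOne` fails for `fCE R` with any admissible `R` —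
`C(f) = ∞` and `f` is not character-type, yet `h_f(n) = o(n)` fails. [folklore] -/
theorem ckStatementOne_false_of (hdir : DirichletReciprocalDivergence) :
    ¬ CKStatementOne := by
  intro hconj
  obtain ⟨R, hRinf, hRP, hR8⟩ := exists_admissible_R
  obtain ⟨hM, _, _, _, hC, hnc, _, hno⟩ := theoremCE hdir R hRinf hRP hR8
  exact hno ((hconj (fCE R) hM.isMultPM hnc).mpr hC)

/-! ### Smoke tests (definitions are not vacuous) -/

-- `f₀` takes both values
example : f0 1 = 1 := f0_one
example : f0 2 = 1 := f0_two
example : f0 3 = -1 := by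
  rw [f0_odd (by norm_num)]
  exact ZMod.χ₄_nat_three_mod_four (by norm_num)
example : f0 5 = 1 := by
  rw [f0_odd (by norm_num)]
  exact ZMod.χ₄_nat_one_mod_four (by norm_num)

-- with `R = ∅` there is no flip: `fCE ∅ = f₀`
example (n : ℕ) : fCE ∅ n = f0 n :=
  fCE_eq_f0_of_no_factor_in ∅ fun p hp => absurd hp (Set.notMem_empty p)

-- Lemma 2.1 at `s = 2`, checked against a direct expansion of the sum
example : hCK f0 4 = -1 := by
  have h := hCK_f0_two_pow (s := 2) le_rfl
  norm_num at h
  exact h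
example : hCK f0 4 = f0 1 * f0 3 + f0 2 * f0 2 + f0 3 * f0 1 := by
  have h1 : Finset.Ico 1 4 = {1, 2, 3} := by decide
  rw [hCK, h1]
  rw [Finset.sum_insert (by decide), Finset.sum_insert (by decide),
    Finset.sum_singleton]
  norm_num [add_assoc]

-- the interface sets are non-empty (7 ≡ 3 mod 4 is prime)
example : (7 : ℕ) ∈ {p : ℕ | p.Prime ∧ p % 4 = 3 % 4} := ⟨by norm_num, by norm_num⟩

-- the bound of Theorem 1.1 is negative from s = 3 on (so h_f(2^s) < 0: sign forced)
example {s : ℕ} (hs : 3 ≤ s) : -(2 ^ (s - 1) : ℤ) + 3 < 0 := by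
  have h4 : (4 : ℤ) ≤ 2 ^ (s - 1) := by
    calc (4 : ℤ) = 2 ^ 2 := by norm_num
    _ ≤ 2 ^ (s - 1) := by
        apply pow_le_pow_right₀ (by norm_num)
        omega
  omega

/-! ### Unconditional forms (the bundle wrapper `Refutations.CorradiKatai1969`) -/

/-- **`CKStatementOne` (Corrádi–Kátai 1969, p. 25, their first proposed statement) is false** — unconditional
(standard axioms): the analytic input is the tree theorem `dirichletReciprocalDivergence`. [cite: CorradiKatai1969, p. 25 Conj. 1] -/
theorem ckStatementOne_false : ¬ CKStatementOne :=
  ckStatementOne_false_of dirichletReciprocalDivergence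

/-- Theorem CE with the Dirichlet hypothesis discharged: for every infinite set `R` of odd primes with all finite
partial sums `Σ_{p∈F⊆R} 1/p ≤ 1/8`, the function `fCE R` is `±1`-valued completely multiplicative, has `f(2) = 1`,
the prescribed prime values, `C(f) = ∞`, is not of character-type, satisfies `h_f(2^s) ≤ −2^{s−1}+3` (`s ≥ 2`), and
`h_f(n) ≠ o(n)`. [folklore] -/
theorem counterexample (R : Set ℕ) (hRinf : R.Infinite) (hRP : ∀ p ∈ R, Nat.Prime p ∧ p % 2 = 1)
    (hR8 : ∀ F : Finset ℕ, (∀ p ∈ F, p ∈ R) → ∑ p ∈ F, (1 : ℝ) / p ≤ 1 / 8) :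
    IsCompletelyMultPM (fCE R) ∧
    fCE R 2 = 1 ∧
    (∀ p : ℕ, p.Prime → p % 2 = 1 → p ∉ R → fCE R p = ZMod.χ₄ ((p : ℕ) : ZMod 4)) ∧
    (∀ p ∈ R, fCE R p = - ZMod.χ₄ ((p : ℕ) : ZMod 4)) ∧
    CInfinite (fCE R) ∧
    ¬ IsCharacterType (fCE R) ∧
    (∀ s : ℕ, 2 ≤ s → hCK (fCE R) (2 ^ s) ≤ -(2 ^ (s - 1) : ℤ) + 3) ∧
    ¬ IsLittleO (hCK (fCE R)) :=
  theoremCE dirichletReciprocalDivergence R hRinf hRP hR8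

/-- Non-vacuity packaged: there IS an `f ∈ M*`, not of character-type, with `C(f) = ∞` and `h_f(n) ≠ o(n)`. [folklore] -/
theorem exists_counterexample :
    ∃ f : ℕ → ℤ, IsCompletelyMultPM f ∧ CInfinite f ∧ ¬ IsCharacterType f ∧ ¬ IsLittleO (hCK f) := by
  obtain ⟨R, hRinf, hRP, hR8⟩ := exists_admissible_R
  obtain ⟨hM, -, -, -, hC, hnc, -, hno⟩ := counterexample R hRinf hRP hR8
  exact ⟨fCE R, hM, hC, hnc, hno⟩

end

end Literature.NumberTheory.Multiplicative.CorradiKatai1969
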